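import Mathlib.LinearAlgebra.Matrix.PosDef
import Mathlib.Algebra.QuadraticDiscriminant
import HarnessLib

/-!
# Bilinear contraction certificates: `[[A, B], [Bᵀ, D]] ⪰ 0 ⟹ (xᵀ B y)² ≤ (xᵀ A x)(yᵀ D y)`
# (Sahi programme, prover prim-sahi-p2 gen 61)

Support file (`--supports stmt-CriticalPhenomena-4575`, helper).  Standard axioms, no sorries, no definitions.  Memo
`run/shared/lean/prim/prim-sahi/FROM-prim-sahi-p2-gen61-TRANSFER-MATRIX.md` §4f, §8(1).

The per-`k` certificates of the boundary-star cycle inequality `bad² ≤ #P1·#P2` found in gen 61 (SDP; `k ≤ 5`) have the shape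
`#P1 = xᵀ D₁ x`, `#P2 = yᵀ D₂ y`, `bad = xᵀ J y` (x, y vectors of letter-word monomials, `D₁, D₂` diagonal multiplicity matrices, `J` a SIGNED
matrix) together with positive semidefiniteness of the block matrix `[[D₁, J], [Jᵀ, D₂]]`.  This file proves the elementary principle that turns
such a certificate into the inequality, for arbitrary real matrices and arbitrary finite index types:
* **`bilin_sq_le_of_fromBlocks_nonneg`** [folklore; this work as stated] — if `v ↦ vᵀ [[A,B],[Bᵀ,D]] v` is nonnegative on all of `ℝ^(m ⊕ n)` then
  `(x ⬝ᵥ B *ᵥ y)² ≤ (x ⬝ᵥ A *ᵥ x) · (y ⬝ᵥ D *ᵥ y)` for all `x, y` (discriminant of the quadratic `t ↦ (x + t y)`-form).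
* **`bilin_sq_le_of_posSemidef`** — the same from `Matrix.PosSemidef (Matrix.fromBlocks A B Bᵀ D)`.
[folklore] (Schur complement / Cauchy–Schwarz for a positive semidefinite block form).
-/

namespace Summit.CriticalPhenomena.PercolationContinuityZ3.Theorems.ProductFormContraction

open Matrix

variable {m n : Type*} [Fintype m] [Fintype n]

/-- The block quadratic form evaluated at `(x, t • y)`. [folklore] -/
theorem fromBlocks_quadForm_elim (A : Matrix m m ℝ) (B : Matrix m n ℝ) (D : Matrix n n ℝ)
    (x : m → ℝ) (y : n → ℝ) (t : ℝ) :
    Sum.elim x (t • y) ⬝ᵥ (Matrix.fromBlocks A B Bᵀ D *ᵥ Sum.elim x (t • y)) =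
      x ⬝ᵥ (A *ᵥ x) + 2 * t * (x ⬝ᵥ (B *ᵥ y)) + t * t * (y ⬝ᵥ (D *ᵥ y)) := by
  rw [Matrix.fromBlocks_mulVec]
  simp only [Sum.elim_comp_inl, Sum.elim_comp_inr, sumElim_dotProduct_sumElim]
  have h1 : x ⬝ᵥ (B *ᵥ (t • y)) = t * (x ⬝ᵥ (B *ᵥ y)) := by
    rw [Matrix.mulVec_smul, dotProduct_smul, smul_eq_mul]
  have h2 : (t • y) ⬝ᵥ (Bᵀ *ᵥ x) = t * (x ⬝ᵥ (B *ᵥ y)) := by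
    rw [smul_dotProduct, smul_eq_mul, Matrix.mulVec_transpose, dotProduct_comm, ← Matrix.dotProduct_mulVec]
  have h3 : (t • y) ⬝ᵥ (D *ᵥ (t • y)) = t * t * (y ⬝ᵥ (D *ᵥ y)) := by
    rw [Matrix.mulVec_smul, smul_dotProduct, dotProduct_smul, smul_eq_mul, smul_eq_mul, mul_assoc]
  rw [dotProduct_add, dotProduct_add, h1, h2, h3]
  ring

/-- **Bilinear Cauchy–Schwarz from a nonnegative block form.**  If `vᵀ [[A, B], [Bᵀ, D]] v ≥ 0` for every `v`, then
`(xᵀ B y)² ≤ (xᵀ A x)·(yᵀ D y)`. [folklore; this work as stated] -/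
theorem bilin_sq_le_of_fromBlocks_nonneg (A : Matrix m m ℝ) (B : Matrix m n ℝ) (D : Matrix n n ℝ)
    (h : ∀ v : m ⊕ n → ℝ, 0 ≤ v ⬝ᵥ (Matrix.fromBlocks A B Bᵀ D *ᵥ v)) (x : m → ℝ) (y : n → ℝ) :
    (x ⬝ᵥ (B *ᵥ y)) ^ 2 ≤ (x ⬝ᵥ (A *ᵥ x)) * (y ⬝ᵥ (D *ᵥ y)) := by
  set a := y ⬝ᵥ (D *ᵥ y) with ha
  set b := 2 * (x ⬝ᵥ (B *ᵥ y)) with hb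
  set c := x ⬝ᵥ (A *ᵥ x) with hc
  have hq : ∀ t : ℝ, 0 ≤ a * (t * t) + b * t + c := by
    intro t
    have := h (Sum.elim x (t • y))
    rw [fromBlocks_quadForm_elim] at this
    nlinarith [this]
  have hd := discrim_le_zero hq
  rw [discrim] at hd
  nlinarith [hd]

/-- **Bilinear Cauchy–Schwarz from a positive semidefinite block matrix** (`Matrix.PosSemidef` form). [folklore] -/
theorem bilin_sq_le_of_posSemidef (A : Matrix m m ℝ) (B : Matrix m n ℝ) (D : Matrix n n ℝ)
    (h : (Matrix.fromBlocks A B Bᵀ D).PosSemidef) (x : m → ℝ) (y : n → ℝ) :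
    (x ⬝ᵥ (B *ᵥ y)) ^ 2 ≤ (x ⬝ᵥ (A *ᵥ x)) * (y ⬝ᵥ (D *ᵥ y)) := by
  refine bilin_sq_le_of_fromBlocks_nonneg A B D (fun v => ?_) x y
  simpa using h.dotProduct_mulVec_nonneg v

/-- **Gram form.**  If the block matrix is a Gram matrix `Lᵀ L` then the bilinear bound holds (the shape in which numerical certificates are
rationalised: an explicit factor `L`). [folklore] -/
theorem bilin_sq_le_of_gram {p : Type*} [Fintype p] (A : Matrix m m ℝ) (B : Matrix m n ℝ) (D : Matrix n n ℝ)
    (L : Matrix p (m ⊕ n) ℝ) (hL : Matrix.fromBlocks A B Bᵀ D = Lᵀ * L) (x : m → ℝ) (y : n → ℝ) :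
    (x ⬝ᵥ (B *ᵥ y)) ^ 2 ≤ (x ⬝ᵥ (A *ᵥ x)) * (y ⬝ᵥ (D *ᵥ y)) := by
  refine bilin_sq_le_of_fromBlocks_nonneg A B D (fun v => ?_) x y
  rw [hL, ← Matrix.mulVec_mulVec, Matrix.dotProduct_mulVec, Matrix.vecMul_transpose]
  exact Finset.sum_nonneg fun i _ => mul_self_nonneg _

/-- **LDLᵀ form.**  If the block matrix factors as `Lᵀ · diagonal d · L` with `d ≥ 0` (an exact rational LDLᵀ certificate, no square roots) then
the bilinear bound holds. [folklore] -/
theorem bilin_sq_le_of_ldl {p : Type*} [Fintype p] [DecidableEq p] (A : Matrix m m ℝ) (B : Matrix m n ℝ) (D : Matrix n n ℝ)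
    (L : Matrix p (m ⊕ n) ℝ) (d : p → ℝ) (hd : 0 ≤ d) (hL : Matrix.fromBlocks A B Bᵀ D = Lᵀ * Matrix.diagonal d * L)
    (x : m → ℝ) (y : n → ℝ) :
    (x ⬝ᵥ (B *ᵥ y)) ^ 2 ≤ (x ⬝ᵥ (A *ᵥ x)) * (y ⬝ᵥ (D *ᵥ y)) := by
  refine bilin_sq_le_of_fromBlocks_nonneg A B D (fun v => ?_) x y
  rw [hL, Matrix.mul_assoc, ← Matrix.mulVec_mulVec, Matrix.dotProduct_mulVec, Matrix.vecMul_transpose,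
    ← Matrix.mulVec_mulVec]
  simp only [dotProduct, Matrix.mulVec_diagonal]
  exact Finset.sum_nonneg fun i _ => by
    have := hd i
    simp only [Pi.zero_apply] at this
    nlinarith [mul_self_nonneg ((L *ᵥ v) i)]

end Summit.CriticalPhenomena.PercolationContinuityZ3.Theorems.ProductFormContraction
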